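import Summits.QuantumAdvantage.QuantumAdvantage.Theorems.CharDialPartyDialH2
import Literature.Computability.MetaComplexity.SmolenskyCorrelationRestrict

/-!
# PartyDial (decomp-qadv lens-5 g35), part I1 — §8a–b: the HYBRID law, preliminaries: the named analytic hypothesis LowDegIndep3At, grid parity with one exceptional cut, address = free part + pair part, exists_even_residue, low degree of pattern events (hasDegF_pattern), card_agree_le

See part A (`CharDialPartyDialA`) for the node header; memo `NODE-g35.md` (g35 folder of decomp-qadv-lens-5).
-/

set_option autoImplicit false
set_option linter.dupNamespace false

namespace Summit.QuantumAdvantage.QuantumAdvantage.Theorems.PartyDial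

open Finset
open Summit.QuantumAdvantage.AdviceFreeQNC0

/-! ## §8  The HYBRID law — the first rung that USES the degree hypothesis: ONE dense cut of `𝔽_p`-degree
`≤ D` plus a `k`-blind rest, GIVEN one named analytic fact (`LowDegIndep3At`: a Boolean function of bounded
`𝔽_p`-degree is nearly independent of the residue of a dense form mod 3 — Bourgain 2005 · Green–Roy–Straubing
2005 · Chattopadhyay 2006 «polynomials over ℤ_m vs MOD_q, gcd(m,q) = 1»; false for `p = 3`, as it must be)

Mechanism.  Keep the canonical grid of §7 for the blind cuts (they fire evenly on every grid), and let the
dense cut `g₀` be arbitrary: all `3^k` grid points over `t` win only if `g₀` fires an ODD number of times on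
the grid, i.e. `N_t := #{z : y_{g₀}(fill t z) ∧ addr ≢ 0}` is odd.  Now `addr = c + g₀ + freeW(t) + pairW(z)`
(the pairs' contribution does not depend on `t`), and for ANY pattern `φ` of `g₀`'s answers on the grid the
three counts `N(φ, r) := #{z : φ z ∧ r + pairW z ≢ 0}`, `r ∈ ℤ/3`, sum to `2·#φ` — so one residue `r(φ)`
makes the count EVEN.  If `y_{g₀}` has degree `≤ D`, the event `{pattern = φ}` is a Boolean function of
degree `≤ 3^k·D` of `t` (product of `3^k` indicators, `Smolensky.mul_mem_lowDeg_add` /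
`comp_subst_mem_lowDeg`), hence — THE FACT — nearly independent of `freeW(t) mod 3`, a form with
`≥ n − 2k` unit coefficients: `#{t : N_t even} ≥ Σ_φ #{pattern = φ ∧ freeW ≡ r(φ) − c − g₀} ≥ 2ⁿ/3 − 2^{3^k}ε2ⁿ
= 2ⁿ/4` for `ε = 1/(12·2^{3^k})`.  Each such `t` yields a loser, each loser arises from `≤ 4^k` such `t`:
`#WIN ≤ (1 − 4^{−(k+1)})·2ⁿ`. -/

section Hybrid

open Literature.Computability.MetaComplexity

variable {n k : ℕ} {lo hi : Fin k → ℕ}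

/-- the linear form `Σ_i w_i·[t_i]`. -/
def linW {m : ℕ} (w : Fin m → ℕ) (t : Fin m → Bool) : ℕ := ∑ i, if t i = true then w i else 0

/-- **THE ANALYTIC FACT as a named hypothesis** `LowDegIndep3At p D ε m₀`: for every Boolean `f` on `{0,1}^m`
of `𝔽_p`-degree `≤ D` and every form `a + Σ w_i [t_i]` with at least `m₀` coefficients `w_i ≢ 0 (mod 3)`, each
residue class mod 3 of the form carries at least `#f/3 − ε·2^m` of the points of `f`.  [For `p ≥ 5` prime and
every `D`, `ε > 0` this holds for some `m₀ = m₀(p, D, ε)` — exponential sums for low-degree polynomials over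
`ℤ_p` against `MOD_3` characters (Bourgain 2005; Green–Roy–Straubing 2005; Chattopadhyay 2006; survey: Viola–
Wigderson, Theory of Computing 4 (2008) §1.2.4).  It is FALSE for `p = 3` (`[Σ tᵢ ≡ 0 (3)]` has `𝔽₃`-degree 2),
matching `¬ WalkHardF 3`.  NOT proved here — it is the hypothesis of the hybrid law, the cell's algebraic input.] -/
def LowDegIndep3At (p : ℕ) [Fact p.Prime] (D : ℕ) (ε : ℝ) (m₀ : ℕ) : Prop :=
  ∀ (m : ℕ) (f : (Fin m → Bool) → Bool), HasDegF p f D →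
    ∀ (w : Fin m → ℕ), m₀ ≤ (univ.filter fun i : Fin m => w i % 3 ≠ 0).card →
    ∀ (a r : ℕ), ((univ.filter fun t : Fin m → Bool => f t = true).card : ℝ) / 3 - ε * (2 : ℝ) ^ m ≤
      ((univ.filter fun t : Fin m → Bool => f t = true ∧ (a + linW w t) % 3 = r % 3).card : ℝ)

/-! ### §8a  Grid parity with one exceptional cut; the address splits as free part + pair part -/

/-- the grid has a loser as soon as the exceptional cut fires an EVEN number of times on it (all other cuts
blind and non-splitting as in §7). -/
theorem grid_loser_except (hP : PairsOK lo hi) (hlt : ∀ j, lo j < n ∧ hi j < n) (t : Fin n → Bool) (c : ℕ)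
    (y : Fin (n + 1) → (Fin n → Bool) → Bool) (g₀ : Fin (n + 1))
    (hbl : ∀ g : Fin (n + 1), g ≠ g₀ → ∃ j : Fin k, (lo j < g.val ↔ hi j < g.val) ∧
      ∀ u v : Fin n → Bool, (∀ i : Fin n, i.val ≠ lo j → i.val ≠ hi j → u i = v i) → y g u = y g v)
    (hev : Even ((univ.filter fun z : Fin k → Fin 3 => y g₀ (fill lo hi t z) = true ∧
      (c + g₀.val + walkExp (fill lo hi t z) g₀.val) % 3 ≠ 0).card)) :
    ∃ z : Fin k → Fin 3, ringWinU c y (fill lo hi t z) = false := by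
  by_contra hall
  push Not at hall
  have hwin : ∀ z : Fin k → Fin 3, (univ.filter fun g : Fin (n + 1) => y g (fill lo hi t z) = true ∧
      (c + g.val + walkExp (fill lo hi t z) g.val) % 3 ≠ 0).card % 2 = 1 := by
    intro z
    have h := hall z
    unfold ringWinU at h
    simpa using h
  set S := ∑ z : Fin k → Fin 3, (univ.filter fun g : Fin (n + 1) => y g (fill lo hi t z) = true ∧
      (c + g.val + walkExp (fill lo hi t z) g.val) % 3 ≠ 0).card with hS
  have h3 : 3 ^ k % 2 = 1 := by
    rw [Nat.pow_mod]; simp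
  have h1 : S % 2 = 1 := by
    rw [hS, Finset.sum_nat_mod, Finset.sum_congr rfl fun z _ => hwin z, Finset.sum_const, smul_eq_mul,
      mul_one, Finset.card_univ, Fintype.card_fun, Fintype.card_fin, Fintype.card_fin, h3]
  have h2 : Even S := by
    have hc : S = ∑ g : Fin (n + 1), (univ.filter fun z : Fin k → Fin 3 => y g (fill lo hi t z) = true ∧
        (c + g.val + walkExp (fill lo hi t z) g.val) % 3 ≠ 0).card := by
      simp only [hS, Finset.card_filter]
      exact Finset.sum_comm
    rw [hc]
    refine Finset.even_sum _ fun g _ => ?_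
    by_cases hg : g = g₀
    · rw [hg]; exact hev
    · obtain ⟨j, hns, hb⟩ := hbl g hg
      exact fire_count_grid_even hP hlt t c y g j hns hb
  obtain ⟨m, hm⟩ := h2
  omega

/-- at a pair coordinate the grid point does not depend on the free assignment. -/
theorem fill_pair_indep (t t' : Fin n → Bool) (z : Fin k → Fin 3) (i : Fin n)
    (h : ¬ ∀ j : Fin k, i.val ≠ lo j ∧ i.val ≠ hi j) : fill lo hi t z i = fill lo hi t' z i := by
  have he : ∃ j : Fin k, i.val = lo j ∨ i.val = hi j := by
    push Not at h
    obtain ⟨j, hj⟩ := h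
    by_cases h1 : i.val = lo j
    · exact ⟨j, Or.inl h1⟩
    · exact ⟨j, Or.inr (hj h1)⟩
  unfold fill
  rw [dif_pos he, dif_pos he]

/-- the FREE part of the walk exponent at cut position `g` (a form in `t` with coefficients `1`/`2` on the free
zone, `0` on the pairs). -/
def freeW (lo hi : Fin k → ℕ) (t : Fin n → Bool) (g : ℕ) : ℕ :=
  ((freeOf lo hi (n := n)).filter fun i => t i = true).card +
    ((freeOf lo hi (n := n)).filter fun i => i.val < g ∧ t i = true).card

/-- the PAIR part (depends on the grid point only). -/
def pairW (lo hi : Fin k → ℕ) (z : Fin k → Fin 3) (g : ℕ) : ℕ :=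
  ((freeOf lo hi (n := n))ᶜ.filter fun i => fill lo hi (fun _ => false) z i = true).card +
    ((freeOf lo hi (n := n))ᶜ.filter fun i => i.val < g ∧ fill lo hi (fun _ => false) z i = true).card

/-- a count over all coordinates = free zone + pairs. -/
theorem card_filter_free_add (P : Fin n → Prop) [DecidablePred P] :
    (univ.filter P).card = ((freeOf lo hi (n := n)).filter P).card + ((freeOf lo hi (n := n))ᶜ.filter P).card := by
  rw [← Finset.card_union_of_disjoint (Finset.disjoint_filter_filter disjoint_compl_right),
    ← Finset.filter_union, Finset.union_compl]

/-- **address split**: `walkExp (fill t z) g = freeW t g + pairW z g`. -/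
theorem walkExp_fill (t : Fin n → Bool) (z : Fin k → Fin 3) (g : ℕ) :
    walkExp (fill lo hi t z) g = freeW lo hi t g + pairW lo hi z g (n := n) := by
  unfold walkExp wt wtPrefix freeW pairW
  rw [card_filter_free_add (lo := lo) (hi := hi) (fun i => fill lo hi t z i = true),
    card_filter_free_add (lo := lo) (hi := hi) (fun i => i.val < g ∧ fill lo hi t z i = true)]
  have hf : ∀ i ∈ freeOf lo hi (n := n), fill lo hi t z i = t i :=
    fun i hi0 => fill_free t z i (mem_filter.1 hi0).2
  have hc : ∀ i ∈ (freeOf lo hi (n := n))ᶜ, fill lo hi t z i = fill lo hi (fun _ => false) z i :=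
    fun i hi0 => fill_pair_indep t _ z i fun h => (mem_compl.1 hi0) (mem_filter.2 ⟨mem_univ _, h⟩)
  rw [Finset.filter_congr (s := freeOf lo hi) (fun i hi0 => by rw [hf i hi0]),
    Finset.filter_congr (s := freeOf lo hi) (p := fun i => i.val < g ∧ fill lo hi t z i = true)
      (fun i hi0 => by rw [hf i hi0]),
    Finset.filter_congr (s := (freeOf lo hi)ᶜ) (p := fun i => fill lo hi t z i = true) (fun i hi0 => by rw [hc i hi0]),
    Finset.filter_congr (s := (freeOf lo hi)ᶜ) (p := fun i => i.val < g ∧ fill lo hi t z i = true)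
      (fun i hi0 => by rw [hc i hi0])]
  ring

/-- the free part IS the form `linW w` with weights `2` (free, before the cut), `1` (free, after), `0` (pairs). -/
theorem freeW_eq_linW (t : Fin n → Bool) (g : ℕ) :
    freeW lo hi t g = linW (fun i : Fin n => if i ∈ freeOf lo hi (n := n) then (if i.val < g then 2 else 1) else 0) t := by
  unfold freeW linW
  rw [← Finset.sum_add_sum_compl (freeOf lo hi (n := n)), Finset.card_filter, Finset.card_filter,
    ← Finset.sum_add_distrib]
  have h0 : ∑ i ∈ (freeOf lo hi (n := n))ᶜ,
      (if t i = true then (if i ∈ freeOf lo hi (n := n) then (if i.val < g then 2 else 1) else 0) else 0) = 0 :=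
    Finset.sum_eq_zero fun i hi0 => by
      have : i ∉ freeOf lo hi (n := n) := mem_compl.1 hi0
      simp [this]
  rw [h0, add_zero]
  refine Finset.sum_congr rfl fun i hi0 => ?_
  by_cases ht : t i = true
  · by_cases hg : i.val < g
    · simp [hi0, ht, hg]
    · simp [hi0, ht, hg]
  · simp [ht]

/-- the weights are non-zero mod 3 exactly on the free zone. -/
theorem card_weights_nonzero (g : ℕ) :
    (univ.filter fun i : Fin n =>
      (if i ∈ freeOf lo hi (n := n) then (if i.val < g then 2 else 1) else 0) % 3 ≠ 0).card =
      (freeOf lo hi (n := n)).card := by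
  congr 1
  ext i
  simp only [mem_filter, mem_univ, true_and]
  by_cases h : i ∈ freeOf lo hi (n := n)
  · by_cases hg : i.val < g <;> simp [h, hg]
  · simp [h]

/-- the free zone has at least `n − 2k` coordinates. -/
theorem card_freeOf_ge : n ≤ (freeOf lo hi (n := n)).card + 2 * k := by
  have h := Finset.card_add_card_compl (freeOf lo hi (n := n))
  rw [Fintype.card_fin] at h
  have h2 := card_compl_freeOf_le (lo := lo) (hi := hi) (n := n)
  omega

/-! ### §8b  One residue makes the exceptional count even; low degree of the pattern events -/

/-- for every answer pattern `φ` on the grid and every pair part `s`, some residue `r` of the free part makes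
`#{z : φ z ∧ r + s z ≢ 0 (3)}` EVEN (the three counts sum to `2·#φ`). -/
theorem exists_even_residue (φ : (Fin k → Fin 3) → Bool) (s : (Fin k → Fin 3) → ℕ) :
    ∃ r : Fin 3, Even ((univ.filter fun z : Fin k → Fin 3 => φ z = true ∧ (r.val + s z) % 3 ≠ 0).card) := by
  by_contra h
  push Not at h
  have hodd : ∀ r : Fin 3, Odd ((univ.filter fun z : Fin k → Fin 3 => φ z = true ∧ (r.val + s z) % 3 ≠ 0).card) :=
    fun r => Nat.not_even_iff_odd.1 (h r)
  have hcnt : ∀ z : Fin k → Fin 3, (∑ r : Fin 3, if (r.val + s z) % 3 ≠ 0 then 1 else 0) = 2 := by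
    intro z
    rw [← Finset.card_filter,
      Finset.filter_congr (q := fun r : Fin 3 => (s z + 1 * r.val) % 3 ≠ 0) fun r _ => by rw [one_mul, Nat.add_comm]]
    exact card_fire_two (s z) 1 (Or.inr rfl)
  have hsum : ∑ r : Fin 3, (univ.filter fun z : Fin k → Fin 3 => φ z = true ∧ (r.val + s z) % 3 ≠ 0).card =
      2 * (univ.filter fun z : Fin k → Fin 3 => φ z = true).card := by
    simp only [Finset.card_filter]
    rw [Finset.sum_comm, Finset.mul_sum]
    refine Finset.sum_congr rfl fun z _ => ?_
    cases hz : φ z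
    · simp
    · simp only [true_and, if_true, mul_one]
      exact hcnt z
  obtain ⟨a, ha⟩ := hodd 0
  obtain ⟨b, hb⟩ := hodd 1
  obtain ⟨d, hd⟩ := hodd 2
  have h3 := Fin.sum_univ_three fun r : Fin 3 =>
    (univ.filter fun z : Fin k → Fin 3 => φ z = true ∧ (r.val + s z) % 3 ≠ 0).card
  omega

/-- the dense cut's answer at a fixed grid column is a degree-`≤ D` function of the free assignment. -/
theorem hasDegF_fill {p : ℕ} [Fact p.Prime] {D : ℕ} {f : (Fin n → Bool) → Bool} (hf : HasDegF p f D)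
    (z : Fin k → Fin 3) : HasDegF p (fun t => f (fill lo hi t z)) D := by
  unfold HasDegF at hf ⊢
  refine Smolensky.comp_subst_mem_lowDeg (F := ZMod p) (fun t : Fin n → Bool => fill lo hi t z)
    (fun i => ?_) hf
  by_cases h : ∃ j : Fin k, i.val = lo j ∨ i.val = hi j
  · left
    refine ⟨fill lo hi (fun _ => false) z i, fun t => ?_⟩
    unfold fill
    rw [dif_pos h, dif_pos h]
  · right
    exact ⟨i, fun t => by unfold fill; rw [dif_neg h]⟩

/-- a product of `#s` functions of degree `≤ D` has degree `≤ #s·D`. -/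
theorem prod_mem_lowDeg {p : ℕ} [Fact p.Prime] {m D : ℕ} {ι : Type*} [DecidableEq ι] (s : Finset ι)
    (F : ι → Smolensky.CubeFn (ZMod p) m) (h : ∀ i ∈ s, F i ∈ Smolensky.lowDeg (ZMod p) m D) :
    (∏ i ∈ s, F i) ∈ Smolensky.lowDeg (ZMod p) m (s.card * D) := by
  induction s using Finset.induction_on with
  | empty =>
    rw [Finset.prod_empty, Finset.card_empty, zero_mul]
    exact Smolensky.one_mem_lowDeg 0
  | insert a s ha ih =>
    have hcard : (insert a s).card * D = D + s.card * D := by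
      rw [Finset.card_insert_of_notMem ha]; ring
    rw [Finset.prod_insert ha, hcard]
    exact Smolensky.mul_mem_lowDeg_add (h a (Finset.mem_insert_self a s))
      (ih fun i hi0 => h i (Finset.mem_insert_of_mem hi0))

/-- **pattern events have bounded degree**: if each `F i` has degree `≤ D`, the indicator of
`{t : ∀ i, F i t = φ i}` has degree `≤ (#ι)·D`. -/
theorem hasDegF_pattern {p : ℕ} [Fact p.Prime] {m D : ℕ} {ι : Type*} [Fintype ι] [DecidableEq ι]
    (F : ι → (Fin m → Bool) → Bool) (hF : ∀ i, HasDegF p (F i) D) (φ : ι → Bool) :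
    HasDegF p (fun t => decide (∀ i, F i t = φ i)) (Fintype.card ι * D) := by
  unfold HasDegF at hF ⊢
  set fac : ι → Smolensky.CubeFn (ZMod p) m := fun i t => if F i t = φ i then 1 else 0 with hfac_def
  have hfac : ∀ i, fac i ∈ Smolensky.lowDeg (ZMod p) m D := by
    intro i
    cases hφ : φ i
    · have he : fac i = 1 - fun t => if F i t = true then (1 : ZMod p) else 0 := by
        funext t
        simp only [hfac_def, hφ, Pi.sub_apply, Pi.one_apply]
        cases F i t <;> simp
      rw [he]
      exact Submodule.sub_mem _ (Smolensky.one_mem_lowDeg D) (hF i)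
    · have he : fac i = fun t => if F i t = true then (1 : ZMod p) else 0 := by
        funext t
        simp only [hfac_def, hφ]
      rw [he]
      exact hF i
  have hprod := prod_mem_lowDeg (univ : Finset ι) fac fun i _ => hfac i
  rw [Finset.card_univ] at hprod
  have heq : (fun t : Fin m → Bool => if decide (∀ i, F i t = φ i) = true then (1 : ZMod p) else 0) =
      ∏ i ∈ (univ : Finset ι), fac i := by
    funext t
    rw [Finset.prod_apply]
    by_cases hall : ∀ i, F i t = φ i
    · rw [if_pos (decide_eq_true hall)]
      exact (Finset.prod_eq_one fun i _ => by simp [hfac_def, hall i]).symm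
    · rw [if_neg (by simpa using hall)]
      push Not at hall
      obtain ⟨i, hi0⟩ := hall
      exact (Finset.prod_eq_zero (Finset.mem_univ i) (by simp [hfac_def, hi0])).symm
  rw [heq]
  exact hprod

/-- assignments agreeing with `u` on `F` number at most `2^{#Fᶜ}`. -/
theorem card_agree_le (F : Finset (Fin n)) (u : Fin n → Bool) :
    (univ.filter fun t : Fin n → Bool => ∀ i ∈ F, t i = u i).card ≤ 2 ^ (Fᶜ.card) := by
  have h := Finset.card_le_card_of_injOn (s := univ.filter fun t : Fin n → Bool => ∀ i ∈ F, t i = u i)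
    (t := (univ : Finset (↥(Fᶜ : Finset (Fin n)) → Bool))) (fun t i => t i.1) (fun _ _ => mem_univ _)
    (by
      intro t ht t' ht' heq
      funext i
      by_cases hi0 : i ∈ F
      · exact ((mem_filter.1 (Finset.mem_coe.1 ht)).2 i hi0).trans ((mem_filter.1 (Finset.mem_coe.1 ht')).2 i hi0).symm
      · exact congrFun heq ⟨i, mem_compl.2 hi0⟩)
  rwa [card_univ, Fintype.card_fun, Fintype.card_bool, Fintype.card_coe] at h

end Hybrid

end Summit.QuantumAdvantage.QuantumAdvantage.Theorems.PartyDial
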